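/- Width seat `ym-line-sfw-p2-w5` (prover-ym-line-sfw-p2-w5-g18-0), free hands for planner ym-idea-2's STUB-PLAN-E (LINE-17 on crux
`AllWindowsColdBox.BoxMidWindowsSU22` = stmt-QuantumFields-24003, stub E `stub_tiltMoments`), piece E(3), second half: the `K ⪯ I` / Gram bound. -/
import Summits.QuantumFields.YangMills.Theorems.AllWindowsColdBoxTiltCubicForm
import Summits.QuantumFields.YangMills.Theorems.AllWindowsColdBoxTiltCubicColourSeparation
import Summits.QuantumFields.YangMills.Theorems.AllWindowsColdBoxDirProjKernelContraction
import Summits.QuantumFields.YangMills.Theorems.WeakCouplingRatesColdBoxDirichletForm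

/-!
# The Gram norm of the cubic tensor of the tilt: `Σ B B' ΓΓΓ ≤ 36·D³·M²·#(plaquettes touching Λ)` (STUB-PLAN-E, piece E(3), second half)

With `C = Q_D⁻¹` (the covariance of one colour of `gaussD`, `|C_{yy'}| ≤ M`) the Gram norm of the cubic tensor of the tilt separates into the
colour factor `Σ_{αβγ} τ² ≤ 4D³` and the edge factor `Σ_{xyzx'y'z'} A_{xyz}A_{x'y'z'}C_{xx'}C_{yy'}C_{zz'}` (`sum6_tiltCubicTensor_eq`, from the generic
`sum6_tensor_blockKernel_eq`), `A_{xyz} = Σ_q λ_q(x)·P_q(y,z)` (`legTensor`).  Summing the first slot first gives the Dirichlet PROJECTION kernel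
`K_{qq'} = λ_q·Q_D⁻¹λ_{q'} = boxDirProjKernel H q q'`, the other two slots give the leg-pair Gram matrix `G_{qq'} = ⟨P_q, (C⊗C)P_{q'}⟩` (`legGram`),
so the edge factor is `Σ_{qq'} K_{qq'}G_{qq'}` (`legTensor_norm_eq_sum_kernel_mul_legGram`); `K ⪯ I` (`sum_sum_boxDirProjKernel_mul_gram_le`,
✓ `AllWindowsColdBoxDirProjKernelContraction`) bounds it by `Σ_q G_qq` once `G` is an explicit Gram matrix (`legGram_eq_sum_legGramVec`, from the
Gram form of the covariance `dirQinv_eq_sum_mulVec` — no square roots), and `G_qq ≤ 9·M²` because a leg-pair vector has `ℓ¹` mass `≤ 3`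
(`sum_abs_legPair_le`, `gramDiag_le`).

Main results: **`legTensor_norm_le`** (`Σ AA'CCC ≤ 9·M²·#touching`) and **`sum6_tiltCubicTensor_le`**:
`Σ_{abca'b'c'} B_{abc}B_{a'b'c'}Γ_{aa'}Γ_{bb'}Γ_{cc'} ≤ 36·(dimE ρ)³·M²·#(plaquettesTouching Λ)` for every colour-block-diagonal `Γ` with blocks
`Q_D⁻¹` — the right-hand side of `CubicChaos.integral_cubicForm_sq_le` for the cubic part of the tilt; with `M = 16H` (stub C) and `#touching ≍ H⁴`
this is the planner's `Var(V₃) ≤ K₃·H⁶/β` (STUB-PLAN-E §2 E(3)); obligation D (`λ_max`) is not used.  Three definitions (`dirMu`, `legGramVec`,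
`legGram`); standard axioms.  HONEST LABEL: helper toward the open registered stub E of a critic-passed line on the R2ξ″ RECORD-rung crux 24003; no
stub is proved by name, no crux, rung or summit is proved; the Yang–Mills mass gap is NOT proved by this file.
-/

set_option autoImplicit false

noncomputable section

open MeasureTheory Finset Matrix
open Literature.Probability.LatticeModels (Site halfOpenBox)
open Literature.MathematicalPhysics.QuantumLattice
open Literature.MathematicalPhysics.QuantumFieldTheory
open Literature.MathematicalPhysics.QuantumFieldTheory.LatticeMaxwell
open Literature.MathematicalPhysics.QuantumFieldTheory.AxialGauge
open Summit.QuantumFields.YangMills.Theorems.WeakCouplingRates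
open Summit.QuantumFields.YangMills.Theorems.FreeEnergyLogCoefficient
open Summit.QuantumFields.YangMills.Theorems.AllWindowsColdBox

namespace Summit.QuantumFields.YangMills.Theorems.ColdBoxAllGroups

/-! ## §1 The instance: colour separation for the cubic tensor of the tilt -/

section Tilt

variable {N : ℕ} {G : Type*} [Group G] (ρ : G →* Matrix (Fin N) (Fin N) ℂ) {H : ℕ}

/-- **Colour separation for the cubic tensor of the tilt**: against any colour-block-diagonal kernel `Γ_{ab} = [a₁ = b₁]·C_{a₂b₂}`,
`Σ_{abca'b'c'} B_{abc}B_{a'b'c'}Γ_{aa'}Γ_{bb'}Γ_{cc'} = (Σ_{αβγ} τ_{αβγ}²)·Σ_{xyzx'y'z'} A_{xyz}A_{x'y'z'}C_{xx'}C_{yy'}C_{zz'}` with `B = tiltCubicTensor ρ H`,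
`τ_{αβγ} = chartCubic ρ e_α e_β e_γ`, `A = legTensor H`. -/
theorem sum6_tiltCubicTensor_eq (C : DirFree H → DirFree H → ℝ) (Γ : Fin (dimE ρ) × DirFree H → Fin (dimE ρ) × DirFree H → ℝ)
    (hΓ : ∀ a b, Γ a b = if a.1 = b.1 then C a.2 b.2 else 0) :
    (∑ a : Fin (dimE ρ) × DirFree H, ∑ b : Fin (dimE ρ) × DirFree H, ∑ c : Fin (dimE ρ) × DirFree H,
      ∑ a' : Fin (dimE ρ) × DirFree H, ∑ b' : Fin (dimE ρ) × DirFree H, ∑ c' : Fin (dimE ρ) × DirFree H,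
        tiltCubicTensor ρ H a b c * tiltCubicTensor ρ H a' b' c' * (Γ a a' * Γ b b' * Γ c c')) =
      (∑ α : Fin (dimE ρ), ∑ β : Fin (dimE ρ), ∑ γ : Fin (dimE ρ),
          chartCubic ρ (EuclideanSpace.single α 1) (EuclideanSpace.single β 1) (EuclideanSpace.single γ 1) ^ 2) *
        ∑ x : DirFree H, ∑ y : DirFree H, ∑ z : DirFree H, ∑ x' : DirFree H, ∑ y' : DirFree H, ∑ z' : DirFree H,
          legTensor H x y z * legTensor H x' y' z' * (C x x' * C y y' * C z z') :=
  sum6_tensor_blockKernel_eq (fun α β γ => chartCubic ρ (EuclideanSpace.single α 1) (EuclideanSpace.single β 1) (EuclideanSpace.single γ 1))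
    (legTensor H) C Γ hΓ

/-- **The colour factor is at most `4·D³`**: `Σ_{αβγ} τ_{αβγ}² ≤ 4·(dimE ρ)³` (`|τ_{αβγ}| ≤ 2`). -/
theorem sum_sq_chartCubic_single_le :
    (∑ α : Fin (dimE ρ), ∑ β : Fin (dimE ρ), ∑ γ : Fin (dimE ρ),
        chartCubic ρ (EuclideanSpace.single α 1) (EuclideanSpace.single β 1) (EuclideanSpace.single γ 1) ^ 2) ≤
      4 * (dimE ρ : ℝ) ^ 3 := by
  have h4 : ∀ α β γ : Fin (dimE ρ),
      chartCubic ρ (EuclideanSpace.single α 1) (EuclideanSpace.single β 1) (EuclideanSpace.single γ 1) ^ 2 ≤ 4 := by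
    intro α β γ
    have h := abs_chartCubic_single_le ρ α β γ
    have h0 := abs_nonneg (chartCubic ρ (EuclideanSpace.single α 1) (EuclideanSpace.single β 1) (EuclideanSpace.single γ 1))
    rw [← sq_abs]
    nlinarith
  calc (∑ α : Fin (dimE ρ), ∑ β : Fin (dimE ρ), ∑ γ : Fin (dimE ρ),
        chartCubic ρ (EuclideanSpace.single α 1) (EuclideanSpace.single β 1) (EuclideanSpace.single γ 1) ^ 2)
      ≤ ∑ _α : Fin (dimE ρ), ∑ _β : Fin (dimE ρ), ∑ _γ : Fin (dimE ρ), (4 : ℝ) :=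
        Finset.sum_le_sum fun α _ => Finset.sum_le_sum fun β _ => Finset.sum_le_sum fun γ _ => h4 α β γ
    _ = 4 * (dimE ρ : ℝ) ^ 3 := by
        simp only [Finset.sum_const, Finset.card_univ, Fintype.card_fin]
        ring

end Tilt

section LegPairs

variable {H : ℕ}

/-! ## §2 The leg-pair vectors: `ℓ¹` bound and the diagonal Gram bound -/

/-- `legInd` is an indicator. -/
theorem legInd_nonneg (y : DirFree H) (e : Literature.MathematicalPhysics.QuantumLattice.ZdEdge 4) : 0 ≤ legInd y e := by
  unfold legInd; split_ifs <;> norm_num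

/-- At most one free Dirichlet index sits on a given edge: `Σ_y [y = e] ≤ 1`. -/
theorem sum_legInd_le_one (e : Literature.MathematicalPhysics.QuantumLattice.ZdEdge 4) : ∑ y : DirFree H, legInd y e ≤ 1 := by
  classical
  have h : ∑ y : DirFree H, legInd y e = ((Finset.univ.filter fun y : DirFree H =>
      (y.1.1 : Literature.MathematicalPhysics.QuantumLattice.ZdEdge 4) = e).card : ℝ) := by
    rw [← Finset.sum_boole]
    exact Finset.sum_congr rfl fun y _ => by simp only [legInd]
  rw [h]
  have hc : (Finset.univ.filter fun y : DirFree H =>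
      (y.1.1 : Literature.MathematicalPhysics.QuantumLattice.ZdEdge 4) = e).card ≤ 1 := by
    refine Finset.card_le_one.2 fun y hy y' hy' => ?_
    rw [Finset.mem_filter] at hy hy'
    exact Subtype.ext (Subtype.ext (hy.2.trans hy'.2.symm))
  exact_mod_cast hc

/-- The product indicator of a pair of edges has total mass `≤ 1` over pairs of free indices. -/
theorem sum_legInd_mul_legInd_le_one (e e' : Literature.MathematicalPhysics.QuantumLattice.ZdEdge 4) :
    ∑ j : DirFree H × DirFree H, legInd j.1 e * legInd j.2 e' ≤ 1 := by
  rw [Fintype.sum_prod_type]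
  dsimp only
  rw [← Finset.sum_mul_sum]
  have h1 := sum_legInd_le_one (H := H) e
  have h2 := sum_legInd_le_one (H := H) e'
  have h0 : 0 ≤ ∑ z : DirFree H, legInd z e' := Finset.sum_nonneg fun z _ => legInd_nonneg z e'
  have h0' : 0 ≤ ∑ y : DirFree H, legInd y e := Finset.sum_nonneg fun y _ => legInd_nonneg y e
  nlinarith

/-- **`ℓ¹` bound of a leg-pair vector**: `Σ_{(y,z)} |legPair q y z| ≤ 3` (six signed pairs of weight `½`, each of mass `≤ 1`). -/
theorem sum_abs_legPair_le (q : Plaq 4) : ∑ j : DirFree H × DirFree H, |legPair q j.1 j.2| ≤ 3 := by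
  have hb : ∀ j : DirFree H × DirFree H, |legPair q j.1 j.2| ≤
      (legInd j.1 (q.1, q.2.1) * legInd j.2 (q.1 + Pi.single q.2.1 1, q.2.2) +
        legInd j.1 (q.1, q.2.1) * legInd j.2 (q.1 + Pi.single q.2.2 1, q.2.1) +
        legInd j.1 (q.1, q.2.1) * legInd j.2 (q.1, q.2.2) +
        legInd j.1 (q.1 + Pi.single q.2.1 1, q.2.2) * legInd j.2 (q.1 + Pi.single q.2.2 1, q.2.1) +
        legInd j.1 (q.1 + Pi.single q.2.1 1, q.2.2) * legInd j.2 (q.1, q.2.2) +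
        legInd j.1 (q.1 + Pi.single q.2.2 1, q.2.1) * legInd j.2 (q.1, q.2.2)) / 2 := by
    intro j
    have n1 := mul_nonneg (legInd_nonneg j.1 (q.1, q.2.1)) (legInd_nonneg j.2 (q.1 + Pi.single q.2.1 1, q.2.2))
    have n2 := mul_nonneg (legInd_nonneg j.1 (q.1, q.2.1)) (legInd_nonneg j.2 (q.1 + Pi.single q.2.2 1, q.2.1))
    have n3 := mul_nonneg (legInd_nonneg j.1 (q.1, q.2.1)) (legInd_nonneg j.2 (q.1, q.2.2))
    have n4 := mul_nonneg (legInd_nonneg j.1 (q.1 + Pi.single q.2.1 1, q.2.2))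
      (legInd_nonneg j.2 (q.1 + Pi.single q.2.2 1, q.2.1))
    have n5 := mul_nonneg (legInd_nonneg j.1 (q.1 + Pi.single q.2.1 1, q.2.2)) (legInd_nonneg j.2 (q.1, q.2.2))
    have n6 := mul_nonneg (legInd_nonneg j.1 (q.1 + Pi.single q.2.2 1, q.2.1)) (legInd_nonneg j.2 (q.1, q.2.2))
    rw [legPair, abs_le]
    constructor <;> linarith
  refine (Finset.sum_le_sum fun j _ => hb j).trans ?_
  rw [← Finset.sum_div]
  simp only [Finset.sum_add_distrib]
  have := sum_legInd_mul_legInd_le_one (H := H) (q.1, q.2.1) (q.1 + Pi.single q.2.1 1, q.2.2)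
  have := sum_legInd_mul_legInd_le_one (H := H) (q.1, q.2.1) (q.1 + Pi.single q.2.2 1, q.2.1)
  have := sum_legInd_mul_legInd_le_one (H := H) (q.1, q.2.1) (q.1, q.2.2)
  have := sum_legInd_mul_legInd_le_one (H := H) (q.1 + Pi.single q.2.1 1, q.2.2) (q.1 + Pi.single q.2.2 1, q.2.1)
  have := sum_legInd_mul_legInd_le_one (H := H) (q.1 + Pi.single q.2.1 1, q.2.2) (q.1, q.2.2)
  have := sum_legInd_mul_legInd_le_one (H := H) (q.1 + Pi.single q.2.2 1, q.2.1) (q.1, q.2.2)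
  linarith

/-- **Diagonal Gram bound**: `G_qq = Σ_{jj'} P_q(j)P_q(j')·C_{j₁j'₁}C_{j₂j'₂} ≤ 9·M²` when `|C| ≤ M` entrywise. -/
theorem gramDiag_le (q : Plaq 4) (C : DirFree H → DirFree H → ℝ) {M : ℝ} (hM : ∀ y y', |C y y'| ≤ M) :
    ∑ j : DirFree H × DirFree H, ∑ j' : DirFree H × DirFree H,
        legPair q j.1 j.2 * legPair q j'.1 j'.2 * (C j.1 j'.1 * C j.2 j'.2) ≤ 9 * M ^ 2 := by
  have hterm : ∀ j j' : DirFree H × DirFree H, legPair q j.1 j.2 * legPair q j'.1 j'.2 * (C j.1 j'.1 * C j.2 j'.2) ≤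
      |legPair q j.1 j.2| * |legPair q j'.1 j'.2| * M ^ 2 := by
    intro j j'
    refine (le_abs_self _).trans ?_
    rw [abs_mul, abs_mul, abs_mul]
    refine mul_le_mul_of_nonneg_left ?_ (by positivity)
    rw [sq]
    exact mul_le_mul (hM _ _) (hM _ _) (abs_nonneg _) ((abs_nonneg _).trans (hM j.1 j'.1))
  calc ∑ j : DirFree H × DirFree H, ∑ j' : DirFree H × DirFree H,
        legPair q j.1 j.2 * legPair q j'.1 j'.2 * (C j.1 j'.1 * C j.2 j'.2)
      ≤ ∑ j : DirFree H × DirFree H, ∑ j' : DirFree H × DirFree H, |legPair q j.1 j.2| * |legPair q j'.1 j'.2| * M ^ 2 :=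
        Finset.sum_le_sum fun j _ => Finset.sum_le_sum fun j' _ => hterm j j'
    _ = (∑ j : DirFree H × DirFree H, |legPair q j.1 j.2|) ^ 2 * M ^ 2 := by
        rw [sq (∑ j : DirFree H × DirFree H, |legPair q j.1 j.2|), Finset.sum_mul_sum, Finset.sum_mul]
        refine Finset.sum_congr rfl fun j _ => ?_
        rw [Finset.sum_mul]
    _ ≤ 3 ^ 2 * M ^ 2 := by
        have h3 := sum_abs_legPair_le (H := H) q
        have h0 : 0 ≤ ∑ j : DirFree H × DirFree H, |legPair q j.1 j.2| := Finset.sum_nonneg fun j _ => abs_nonneg _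
        have := pow_le_pow_left₀ h0 h3 2
        exact mul_le_mul_of_nonneg_right this (sq_nonneg M)
    _ = 9 * M ^ 2 := by norm_num

end LegPairs

/-! ## §3 The Gram matrix of the leg pairs and the projection-kernel form of the edge factor -/

section Kernel

variable {H : ℕ}

variable (H) in
/-- `μ_p = Q_D⁻¹λ_p`: the Gram vectors of the Dirichlet covariance (`dirQinv_eq_sum_mulVec`), `p` a plaquette of the enlarged box in
Chatterjee's coordinates. -/
def dirMu (p : Plaq 4) : DirFree H → ℝ :=
  (Qmat (fun e => e ∉ dirFreeEdges H) dirCorner (2 * H + 3))⁻¹ *ᵥ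
    coeff (fun e => e ∉ dirFreeEdges H) dirCorner (2 * H + 3) (Plaq.shift dirCorner p)

variable (H) in
/-- The Gram vectors of the leg-pair Gram matrix: `legGramVec (m,n) q = Σ_{(y,z)} P_q(y,z)·μ_m(y)·μ_n(z)`. -/
def legGramVec (mn : Plaq 4 × Plaq 4) (q : Plaq 4) : ℝ :=
  ∑ j : DirFree H × DirFree H, legPair q j.1 j.2 * (dirMu H mn.1 j.1 * dirMu H mn.2 j.2)

variable (H) in
/-- **The leg-pair Gram matrix** `G_{qq'} = Σ_{jj'} P_q(j)P_{q'}(j')·C_{j₁j'₁}C_{j₂j'₂} = ⟨P_q, (C⊗C)P_{q'}⟩`, `C = Q_D⁻¹`. -/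
def legGram (q q' : Plaq 4) : ℝ :=
  ∑ j : DirFree H × DirFree H, ∑ j' : DirFree H × DirFree H,
    legPair q j.1 j.2 * legPair q' j'.1 j'.2 *
      ((Qmat (fun e => e ∉ dirFreeEdges H) dirCorner (2 * H + 3))⁻¹ j.1 j'.1 *
        (Qmat (fun e => e ∉ dirFreeEdges H) dirCorner (2 * H + 3))⁻¹ j.2 j'.2)

/-- **`G` is a Gram matrix**: `G_{qq'} = Σ_{(m,n)} legGramVec (m,n) q · legGramVec (m,n) q'` (sum over pairs of plaquettes of the enlarged box). -/
theorem legGram_eq_sum_legGramVec (q q' : Plaq 4) :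
    legGram H q q' = ∑ mn ∈ plaquettesIn (halfOpenBox 4 (2 * H + 3)) ×ˢ plaquettesIn (halfOpenBox 4 (2 * H + 3)),
      legGramVec H mn q * legGramVec H mn q' := by
  have h2 : ∀ j j' : DirFree H × DirFree H, legPair q j.1 j.2 * legPair q' j'.1 j'.2 *
      ((Qmat (fun e => e ∉ dirFreeEdges H) dirCorner (2 * H + 3))⁻¹ j.1 j'.1 *
        (Qmat (fun e => e ∉ dirFreeEdges H) dirCorner (2 * H + 3))⁻¹ j.2 j'.2) =
      ∑ mn ∈ plaquettesIn (halfOpenBox 4 (2 * H + 3)) ×ˢ plaquettesIn (halfOpenBox 4 (2 * H + 3)),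
        legPair q j.1 j.2 * legPair q' j'.1 j'.2 *
          ((dirMu H mn.1 j.1 * dirMu H mn.1 j'.1) * (dirMu H mn.2 j.2 * dirMu H mn.2 j'.2)) := by
    intro j j'
    simp only [dirMu]
    rw [dirQinv_eq_sum_mulVec, dirQinv_eq_sum_mulVec, Finset.sum_mul_sum, ← Finset.sum_product', Finset.mul_sum]
  have hR : ∀ mn : Plaq 4 × Plaq 4, legGramVec H mn q * legGramVec H mn q' =
      ∑ j : DirFree H × DirFree H, ∑ j' : DirFree H × DirFree H,
        legPair q j.1 j.2 * legPair q' j'.1 j'.2 *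
          ((dirMu H mn.1 j.1 * dirMu H mn.1 j'.1) * (dirMu H mn.2 j.2 * dirMu H mn.2 j'.2)) := by
    intro mn
    rw [legGramVec, legGramVec, Finset.sum_mul_sum]
    exact Finset.sum_congr rfl fun j _ => Finset.sum_congr rfl fun j' _ => by ring
  rw [legGram]
  simp only [h2, hR]
  exact (Finset.sum_congr rfl fun j _ => Finset.sum_comm).trans Finset.sum_comm

-- The six-fold product index `X⁶` of the flattened edge sums needs a larger instance-size cap (instance TERM size only; no heartbeats change).
set_option synthInstance.maxSize 512 in
/-- **The edge factor as projection kernel against the leg-pair Gram matrix**: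
`Σ_{xyzx'y'z'} A_{xyz}A_{x'y'z'}C_{xx'}C_{yy'}C_{zz'} = Σ_{q,q' touching} boxDirProjKernel H q q' · G_{qq'}` (`C = Q_D⁻¹`). -/
theorem legTensor_norm_eq_sum_kernel_mul_legGram :
    (∑ x : DirFree H, ∑ y : DirFree H, ∑ z : DirFree H, ∑ x' : DirFree H, ∑ y' : DirFree H, ∑ z' : DirFree H,
        legTensor H x y z * legTensor H x' y' z' *
          ((Qmat (fun e => e ∉ dirFreeEdges H) dirCorner (2 * H + 3))⁻¹ x x' *
            (Qmat (fun e => e ∉ dirFreeEdges H) dirCorner (2 * H + 3))⁻¹ y y' *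
            (Qmat (fun e => e ∉ dirFreeEdges H) dirCorner (2 * H + 3))⁻¹ z z')) =
      ∑ q ∈ plaquettesTouching (boxEdges 4 (2 * H + 1)), ∑ q' ∈ plaquettesTouching (boxEdges 4 (2 * H + 1)),
        boxDirProjKernel H (q.1, q.2.1.1, q.2.1.2) (q'.1, q'.2.1.1, q'.2.1.2) *
          legGram H (q.1, q.2.1.1, q.2.1.2) (q'.1, q'.2.1.1, q'.2.1.2) := by
  classical
  set Qi := (Qmat (fun e => e ∉ dirFreeEdges H) dirCorner (2 * H + 3))⁻¹ with hQi
  set lam : ZdPlaquette 4 → DirFree H → ℝ := fun q =>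
    coeff (fun e => e ∉ dirFreeEdges H) dirCorner (2 * H + 3) ((q.1, q.2.1.1, q.2.1.2) : Plaq 4) with hlam
  set P : ZdPlaquette 4 → DirFree H → DirFree H → ℝ := fun q y z => legPair ((q.1, q.2.1.1, q.2.1.2) : Plaq 4) y z with hP
  -- (b) expand the two leg tensors and bring the plaquette sums outside
  have hb : (∑ x : DirFree H, ∑ y : DirFree H, ∑ z : DirFree H, ∑ x' : DirFree H, ∑ y' : DirFree H, ∑ z' : DirFree H,
        legTensor H x y z * legTensor H x' y' z' * (Qi x x' * Qi y y' * Qi z z')) =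
      ∑ q ∈ plaquettesTouching (boxEdges 4 (2 * H + 1)), ∑ q' ∈ plaquettesTouching (boxEdges 4 (2 * H + 1)),
        ∑ u : DirFree H × DirFree H × DirFree H × DirFree H × DirFree H × DirFree H,
          lam q u.1 * P q u.2.1 u.2.2.1 * (lam q' u.2.2.2.1 * P q' u.2.2.2.2.1 u.2.2.2.2.2) *
            (Qi u.1 u.2.2.2.1 * Qi u.2.1 u.2.2.2.2.1 * Qi u.2.2.1 u.2.2.2.2.2) := by
    rw [CubicChaos.sum6_eq_sum_prod]
    have hexp : ∀ u : DirFree H × DirFree H × DirFree H × DirFree H × DirFree H × DirFree H,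
        legTensor H u.1 u.2.1 u.2.2.1 * legTensor H u.2.2.2.1 u.2.2.2.2.1 u.2.2.2.2.2 *
            (Qi u.1 u.2.2.2.1 * Qi u.2.1 u.2.2.2.2.1 * Qi u.2.2.1 u.2.2.2.2.2) =
          ∑ q ∈ plaquettesTouching (boxEdges 4 (2 * H + 1)), ∑ q' ∈ plaquettesTouching (boxEdges 4 (2 * H + 1)),
            lam q u.1 * P q u.2.1 u.2.2.1 * (lam q' u.2.2.2.1 * P q' u.2.2.2.2.1 u.2.2.2.2.2) *
              (Qi u.1 u.2.2.2.1 * Qi u.2.1 u.2.2.2.2.1 * Qi u.2.2.1 u.2.2.2.2.2) := by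
      intro u
      rw [legTensor, legTensor, Finset.sum_mul_sum, Finset.sum_mul]
      refine Finset.sum_congr rfl fun q _ => ?_
      rw [Finset.sum_mul]
    simp only [hexp]
    exact (Finset.sum_comm).trans (Finset.sum_congr rfl fun q _ => Finset.sum_comm)
  rw [hb]
  refine Finset.sum_congr rfl fun q _ => Finset.sum_congr rfl fun q' _ => ?_
  -- (c) for fixed `q, q'`: reindex the flat sum and compare with the expanded product `K_{qq'} · G_{qq'}`
  set e : DirFree H × DirFree H × DirFree H × DirFree H × DirFree H × DirFree H ≃
      DirFree H × DirFree H × (DirFree H × DirFree H) × (DirFree H × DirFree H) :=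
    { toFun := fun u => (u.1, u.2.2.2.1, (u.2.1, u.2.2.1), (u.2.2.2.2.1, u.2.2.2.2.2))
      invFun := fun v => (v.1, v.2.2.1.1, v.2.2.1.2, v.2.1, v.2.2.2.1, v.2.2.2.2)
      left_inv := fun u => rfl
      right_inv := fun v => rfl } with he
  have hc : (∑ u : DirFree H × DirFree H × DirFree H × DirFree H × DirFree H × DirFree H,
        lam q u.1 * P q u.2.1 u.2.2.1 * (lam q' u.2.2.2.1 * P q' u.2.2.2.2.1 u.2.2.2.2.2) *
          (Qi u.1 u.2.2.2.1 * Qi u.2.1 u.2.2.2.2.1 * Qi u.2.2.1 u.2.2.2.2.2)) =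
      ∑ v : DirFree H × DirFree H × (DirFree H × DirFree H) × (DirFree H × DirFree H),
        lam q v.1 * (Qi v.1 v.2.1 * lam q' v.2.1) *
          (P q v.2.2.1.1 v.2.2.1.2 * P q' v.2.2.2.1 v.2.2.2.2 * (Qi v.2.2.1.1 v.2.2.2.1 * Qi v.2.2.1.2 v.2.2.2.2)) :=
    Fintype.sum_equiv e _ _ fun u => by simp only [he, Equiv.coe_fn_mk]; ring
  rw [hc, boxDirProjKernel, legGram]
  simp only [dotProduct, Matrix.mulVec, hlam, hP, hQi, Fintype.sum_prod_type]
  -- distribute the product `(Σ_x λ·(Σ_x' C λ')) · (Σ_y Σ_z Σ_y' Σ_z' …)` in the fixed order `x, x', y, z, y', z'`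
  rw [Finset.sum_mul]
  refine Finset.sum_congr rfl fun x _ => ?_
  rw [mul_assoc, Finset.sum_mul, Finset.mul_sum]
  refine Finset.sum_congr rfl fun x' _ => ?_
  simp only [Finset.mul_sum]
  refine Finset.sum_congr rfl fun y _ => Finset.sum_congr rfl fun z _ => Finset.sum_congr rfl fun y' _ =>
    Finset.sum_congr rfl fun z' _ => ?_
  ring

/-- **`K ⪯ I` applied**: `Σ_{q,q' touching} boxDirProjKernel H q q' · G_{qq'} ≤ Σ_{q touching} G_{qq}` (the Gram lemma
`sum_sum_boxDirProjKernel_mul_gram_le` with the Gram vectors `legGramVec`, transported from Chatterjee's coordinates of the enlarged box). -/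
theorem sum_kernel_mul_legGram_le :
    (∑ q ∈ plaquettesTouching (boxEdges 4 (2 * H + 1)), ∑ q' ∈ plaquettesTouching (boxEdges 4 (2 * H + 1)),
        boxDirProjKernel H (q.1, q.2.1.1, q.2.1.2) (q'.1, q'.2.1.1, q'.2.1.2) *
          legGram H (q.1, q.2.1.1, q.2.1.2) (q'.1, q'.2.1.1, q'.2.1.2)) ≤
      ∑ q ∈ plaquettesTouching (boxEdges 4 (2 * H + 1)), legGram H (q.1, q.2.1.1, q.2.1.2) (q.1, q.2.1.1, q.2.1.2) := by
  classical
  have hinj : Set.InjOn (fun p : ZdPlaquette 4 => ((p.1 - dirCorner, p.2.1.1, p.2.1.2) : Plaq 4))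
      ↑(plaquettesTouching (boxEdges 4 (2 * H + 1))) := unshift_dirCorner_injective.injOn
  have hS : (plaquettesTouching (boxEdges 4 (2 * H + 1))).image
      (fun p : ZdPlaquette 4 => ((p.1 - dirCorner, p.2.1.1, p.2.1.2) : Plaq 4)) ⊆ plaquettesIn (halfOpenBox 4 (2 * H + 3)) := by
    intro p hp
    obtain ⟨q, hq, rfl⟩ := Finset.mem_image.1 hp
    exact unshift_mem_plaquettesIn hq
  have key := sum_sum_boxDirProjKernel_mul_gram_le H
    (plaquettesIn (halfOpenBox 4 (2 * H + 3)) ×ˢ plaquettesIn (halfOpenBox 4 (2 * H + 3))) _ hS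
    (fun mn p => legGramVec H mn (Plaq.shift dirCorner p))
  simp only [Finset.sum_image hinj, shift_unshift_dirCorner] at key
  simpa only [← legGram_eq_sum_legGramVec, sq] using key

/-- **E(3), edge factor**: `Σ_{xyzx'y'z'} A_{xyz}A_{x'y'z'}C_{xx'}C_{yy'}C_{zz'} ≤ 9·M²·#(plaquettes touching Λ)` for `C = Q_D⁻¹` with `|C| ≤ M`. -/
theorem legTensor_norm_le {M : ℝ} (hM : ∀ y y', |(Qmat (fun e => e ∉ dirFreeEdges H) dirCorner (2 * H + 3))⁻¹ y y'| ≤ M) :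
    (∑ x : DirFree H, ∑ y : DirFree H, ∑ z : DirFree H, ∑ x' : DirFree H, ∑ y' : DirFree H, ∑ z' : DirFree H,
        legTensor H x y z * legTensor H x' y' z' *
          ((Qmat (fun e => e ∉ dirFreeEdges H) dirCorner (2 * H + 3))⁻¹ x x' *
            (Qmat (fun e => e ∉ dirFreeEdges H) dirCorner (2 * H + 3))⁻¹ y y' *
            (Qmat (fun e => e ∉ dirFreeEdges H) dirCorner (2 * H + 3))⁻¹ z z')) ≤
      9 * M ^ 2 * #(plaquettesTouching (boxEdges 4 (2 * H + 1))) := by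
  rw [legTensor_norm_eq_sum_kernel_mul_legGram]
  refine sum_kernel_mul_legGram_le.trans ?_
  calc ∑ q ∈ plaquettesTouching (boxEdges 4 (2 * H + 1)), legGram H (q.1, q.2.1.1, q.2.1.2) (q.1, q.2.1.1, q.2.1.2)
      ≤ ∑ _q ∈ plaquettesTouching (boxEdges 4 (2 * H + 1)), 9 * M ^ 2 :=
        Finset.sum_le_sum fun q _ => by rw [legGram]; exact gramDiag_le _ _ hM
    _ = 9 * M ^ 2 * #(plaquettesTouching (boxEdges 4 (2 * H + 1))) := by
        rw [Finset.sum_const, nsmul_eq_mul]; ring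

end Kernel

/-! ## §4 E(3): the Gram norm of the cubic tensor of the tilt -/

section Final

variable {N : ℕ} {G : Type*} [Group G] (ρ : G →* Matrix (Fin N) (Fin N) ℂ) {H : ℕ}

/-- **E(3).**  For every colour-block-diagonal kernel `Γ_{ab} = [a₁ = b₁]·(Q_D⁻¹)_{a₂b₂}` (the two-point function of the coordinate process of
`gaussD`) and every entrywise bound `|(Q_D⁻¹)_{yy'}| ≤ M`:
`Σ_{abca'b'c'} B_{abc}B_{a'b'c'}Γ_{aa'}Γ_{bb'}Γ_{cc'} ≤ 36·(dimE ρ)³·M²·#(plaquettesTouching Λ)`, `B = tiltCubicTensor ρ H` — the right-hand side of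
`CubicChaos.integral_cubicForm_sq_le` for the cubic part of the tilt (with `tiltCubicW = (√β)⁻¹·Σ B·XXX`: `Var(tiltCubicW) ≤ 216·D³·M²·#touching/β`). -/
theorem sum6_tiltCubicTensor_le (Γ : Fin (dimE ρ) × DirFree H → Fin (dimE ρ) × DirFree H → ℝ)
    (hΓ : ∀ a b, Γ a b = if a.1 = b.1 then (Qmat (fun e => e ∉ dirFreeEdges H) dirCorner (2 * H + 3))⁻¹ a.2 b.2 else 0) {M : ℝ}
    (hM : ∀ y y', |(Qmat (fun e => e ∉ dirFreeEdges H) dirCorner (2 * H + 3))⁻¹ y y'| ≤ M) :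
    (∑ a : Fin (dimE ρ) × DirFree H, ∑ b : Fin (dimE ρ) × DirFree H, ∑ c : Fin (dimE ρ) × DirFree H,
      ∑ a' : Fin (dimE ρ) × DirFree H, ∑ b' : Fin (dimE ρ) × DirFree H, ∑ c' : Fin (dimE ρ) × DirFree H,
        tiltCubicTensor ρ H a b c * tiltCubicTensor ρ H a' b' c' * (Γ a a' * Γ b b' * Γ c c')) ≤
      36 * (dimE ρ : ℝ) ^ 3 * M ^ 2 * #(plaquettesTouching (boxEdges 4 (2 * H + 1))) := by
  have hsep := sum6_tiltCubicTensor_eq ρ _ Γ hΓ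
  rw [hsep]
  set NA := ∑ x : DirFree H, ∑ y : DirFree H, ∑ z : DirFree H, ∑ x' : DirFree H, ∑ y' : DirFree H, ∑ z' : DirFree H,
      legTensor H x y z * legTensor H x' y' z' *
        ((Qmat (fun e => e ∉ dirFreeEdges H) dirCorner (2 * H + 3))⁻¹ x x' *
          (Qmat (fun e => e ∉ dirFreeEdges H) dirCorner (2 * H + 3))⁻¹ y y' *
          (Qmat (fun e => e ∉ dirFreeEdges H) dirCorner (2 * H + 3))⁻¹ z z') with hNA
  set Tτ := ∑ α : Fin (dimE ρ), ∑ β : Fin (dimE ρ), ∑ γ : Fin (dimE ρ),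
      chartCubic ρ (EuclideanSpace.single α 1) (EuclideanSpace.single β 1) (EuclideanSpace.single γ 1) ^ 2 with hTτ
  have hτ : Tτ ≤ 4 * (dimE ρ : ℝ) ^ 3 := sum_sq_chartCubic_single_le ρ
  have hτ0 : 0 ≤ Tτ := Finset.sum_nonneg fun _ _ => Finset.sum_nonneg fun _ _ => Finset.sum_nonneg fun _ _ => sq_nonneg _
  have hNAle : NA ≤ 9 * M ^ 2 * #(plaquettesTouching (boxEdges 4 (2 * H + 1))) := legTensor_norm_le (H := H) hM
  have hD : 0 ≤ 4 * (dimE ρ : ℝ) ^ 3 := mul_nonneg (by norm_num) (pow_nonneg (Nat.cast_nonneg _) 3)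
  rcases le_or_gt 0 NA with h0 | h0
  · calc Tτ * NA ≤ 4 * (dimE ρ : ℝ) ^ 3 * (9 * M ^ 2 * #(plaquettesTouching (boxEdges 4 (2 * H + 1)))) :=
          mul_le_mul hτ hNAle h0 hD
      _ = _ := by ring
  · have h1 : Tτ * NA ≤ 0 := mul_nonpos_iff.2 (Or.inl ⟨hτ0, h0.le⟩)
    have h2 : 0 ≤ 36 * (dimE ρ : ℝ) ^ 3 * M ^ 2 * #(plaquettesTouching (boxEdges 4 (2 * H + 1))) :=
      mul_nonneg (mul_nonneg (mul_nonneg (by norm_num) (pow_nonneg (Nat.cast_nonneg _) 3)) (sq_nonneg M)) (Nat.cast_nonneg _)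
    exact h1.trans h2

end Final

end Summit.QuantumFields.YangMills.Theorems.ColdBoxAllGroups

end
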